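import Literature.NumberTheory.Automorphic.KTypeGrowthOfHarishChandraMultiplicity  -- ★ p830845 (A-p06 (g24)): N5 `kTypeGrowth_of_harishChandraMultiplicity` (+ ★ V19 letter p829390, KF2 ★ p828868)
import Literature.NumberTheory.Automorphic.HarishChandraMultiplicityOfFiltration    -- ★ p831307 (A-p06 (g24)): N4 GLUE `finite_and_finrank_intertwiningMap_harishChandra_le_of_filtration`
import Literature.NumberTheory.Automorphic.UpqGKModulePFiltration                   -- ★ p831041 (A-p14 (g23)): N1 `upqPFiltration`, `exists_mem_upqPFiltration`, `finiteDimensional_upqPFiltration`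
import Literature.NumberTheory.Automorphic.U21HarishChandraLevelBound               -- ★ p832477 (A-p14 (g23)): N3 `u21_levelBound`
import Literature.NumberTheory.Automorphic.FlathLocalLemmas                         -- ★ `exists_irreducible_stable_le`
import HarnessLib

/-!
# Harish-Chandra's `K`-type growth bound for irreducible unitary representations of `U(2,1)`: `dim E(τ) ≤ c · (dim τ)²` — PROVED

Topic `NumberTheory/Automorphic`; namespace `Literature.NumberTheory.Automorphic`; THEOREMS ONLY (no `def`, no named fact, no instance, no notation,
no `sorry`).  Cell `hodgecm-mathlib`, F0∕P3, T1a arch line.  This file is the ★ LITERATURE TWIN of the head of the registered pay-down line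
`Summits/HodgeConjecture/HodgeConjecture/Cruxes/H413/Lines/F0_T1a_V19KTypeGrowthPaydown.lean` (ED. 1 cdc6bbdbd5a1, ED. 2 = all stubs closed): the
`U(2,1)` INSTANCE of the booked letter V19 ★ `IrreducibleUnitaryKTypeGrowth` ([Varadarajan1989, §5.4 Thm. 19] = [Harish-Chandra 1954]) — the statement
**`kTypeGrowth_uTwoOne`** below is that letter's body at `(α, β) = (Fin 2, Fin 1)` TOKEN FOR TOKEN, which is exactly the hypothesis `h19` of ★ C1′
`archIntegratedOperatorTraceClass_forall_of_kTypeGrowthU21` (p831233); so the T1a stub `stub_traceClass` (A5, books row #91) closes in-house by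
`archIntegratedOperatorTraceClass_forall_of_kTypeGrowthU21 kTypeGrowth_uTwoOne`.

THE PROOF (the in-house road N0–N5 of 2026-08-31; [Varadarajan1989, §5.4]; [KnappVogan1995, Prop. 4.87, §IV.6]).  Let `ϖ` be a unitary globalization of an
irreducible `(𝔤, K)`-class of `G = U(2,1)`, `V = H_K^∞` its Harish-Chandra module (an irreducible `(𝔤, K)`-module, ★ p829194).
* `V ≠ 0` is locally `K`-finite, so it contains an IRREDUCIBLE finite-dimensional `K`-stable `W₀ ≠ 0` (`exists_irreducible_kStable_harishChandra`; ★ `exists_irreducible_stable_le`).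
* N1 (★ p831041): the `𝔭`-filtration `F n = Σ_{k≤n} 𝔭^k · W₀` is a monotone chain of finite-dimensional `K`-stable subspaces exhausting `V`.
* N3 (★ p832477, over N0 ★ p830646 Dixmier quasi-simplicity, N2 ★ p831010, the `𝔰𝔩₂`-string calculus ★ p831261∕p831436∕p831696∕p831889∕p832119∕p832358 and the
  generic sockets ★ p831510∕p831571∕p832265): along `F` and its orthogonal complements, `dim Hom_K(τ, F n) ≤ dim W₀` for every irreducible `K`-module `τ`, all `n`.
* N4 (★ p831059 exhaustion, ★ p831104 telescope, ★ p831307 glue): hence `dim Hom_K(τ, H_K^∞) ≤ dim W₀ · dim τ` — **`hcModuleMultBound_uTwoOne`**.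
* N5 (★ p830845, KF2 ★ p828868): `E(τ) ≤ H_K^∞` is finite-dimensional and `dim E(τ) ≤ dim Hom_K(τ, H_K^∞) · dim τ ≤ dim W₀ · (dim τ)²` — **`kTypeGrowth_uTwoOne`**.
HONEST LABEL: this is V19 at `(p, q) = (2, 1)` ONLY (what T1a consumes); the general-`(p,q)` letter ★ `IrreducibleUnitaryKTypeGrowth` stays print (for `q ≥ 2`
the rank-one road does not apply).  HC_CM is proved only modulo the 2 remaining named inputs (hLiu418, h413) — behind them the booked printed statements + the
MOD package — until rung 0 closes.

## References
* V. S. Varadarajan, *An Introduction to Harmonic Analysis on Semisimple Lie Groups* (1989), §5.4 Thm. 19 [Varadarajan1989].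
* Harish-Chandra, *Representations of semisimple Lie groups II*, Trans. AMS 76 (1954) [HarishChandra1954].
* A. W. Knapp, D. A. Vogan, *Cohomological Induction and Unitary Representations* (1995), Prop. 4.87, §IV.6 [KnappVogan1995].
-/

set_option autoImplicit false

noncomputable section

namespace Literature.NumberTheory.Automorphic

open Literature.RepresentationTheory
open Literature.RepresentationTheory.KonnoKonno2007 Literature.RepresentationTheory.KonnoKonno2007.RealDualPair
open Literature.RepresentationTheory.BorelWallach2000
open scoped InnerProductSpace

/-! ## §1 An irreducible `K`-type inside the Harish-Chandra module -/

/-- The `(𝔤, K)`-axioms of `H_K^∞` for a unitary globalization of an irreducible class of `U(2,1)` (★ `isGKModule_harishChandra_holds`).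
[cite: BorelWallach2000, 0 §2.5] -/
theorem isGKModule_harishChandra_uTwoOne {x : GKIrrClass (uFormGroup (Fin 2) (Fin 1))}
    {E : Type} [NormedAddCommGroup E] [InnerProductSpace ℂ E] [CompleteSpace E] {ϖ : ContRepresentation ℂ (uFormGroup (Fin 2) (Fin 1)).carrier E}
    (hϖ : IsUnitaryGlobalization (uFormGroup (Fin 2) (Fin 1)) x ϖ) :
    IsGKModule (uFormGroup (Fin 2) (Fin 1)) (harishChandraRepK (uFormGroup (Fin 2) (Fin 1)) ϖ) (harishChandraRepLie (uFormGroup (Fin 2) (Fin 1)) ϖ hϖ.isStronglyContinuous) :=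
  isGKModule_harishChandra_holds (uFormGroup (Fin 2) (Fin 1)) ϖ hϖ.isStronglyContinuous (harishChandraRepK (uFormGroup (Fin 2) (Fin 1)) ϖ)
    (fun _ _ => rfl) (isHarishChandraModuleOf_harishChandraRepLie (uFormGroup (Fin 2) (Fin 1)) ϖ hϖ.isStronglyContinuous)

/-- **An irreducible finite-dimensional `K`-stable `W₀ ≠ 0` exists in `H_K^∞`** (`H_K^∞ ≠ 0`; every vector is `K`-finite; a finite-dimensional `K`-stable
`Z ≠ 0` contains an irreducible `K`-stable `W₀ ≠ 0`, ★ `exists_irreducible_stable_le`). [cite: KnappVogan1995, §I.3] -/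
theorem exists_irreducible_kStable_harishChandra {x : GKIrrClass (uFormGroup (Fin 2) (Fin 1))}
    {E : Type} [NormedAddCommGroup E] [InnerProductSpace ℂ E] [CompleteSpace E] {ϖ : ContRepresentation ℂ (uFormGroup (Fin 2) (Fin 1)).carrier E}
    (hϖ : IsUnitaryGlobalization (uFormGroup (Fin 2) (Fin 1)) x ϖ) :
    ∃ W₀ : Submodule ℂ (harishChandraSpace (uFormGroup (Fin 2) (Fin 1)) ϖ), FiniteDimensional ℂ W₀ ∧ W₀ ≠ ⊥ ∧
      (∀ (k : (uFormGroup (Fin 2) (Fin 1)).maximalCompact), ∀ w ∈ W₀, harishChandraRepK (uFormGroup (Fin 2) (Fin 1)) ϖ k w ∈ W₀) ∧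
      ∀ U : Submodule ℂ (harishChandraSpace (uFormGroup (Fin 2) (Fin 1)) ϖ), U ≤ W₀ →
        (∀ (k : (uFormGroup (Fin 2) (Fin 1)).maximalCompact), ∀ u ∈ U, harishChandraRepK (uFormGroup (Fin 2) (Fin 1)) ϖ k u ∈ U) → U = ⊥ ∨ U = W₀ := by
  have hV := isGKModule_harishChandra_uTwoOne hϖ
  have hirr := hϖ.isIrreducibleGK_harishChandra
  haveI := hirr.nontrivial
  obtain ⟨v, hv⟩ := exists_ne (0 : harishChandraSpace (uFormGroup (Fin 2) (Fin 1)) ϖ)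
  -- `Z` := the span of the `K`-orbit of `v`: finite-dimensional, `K`-stable, `≠ ⊥`
  let Z : Submodule ℂ (harishChandraSpace (uFormGroup (Fin 2) (Fin 1)) ϖ) := Submodule.span ℂ (Set.range fun k : (uFormGroup (Fin 2) (Fin 1)).maximalCompact => harishChandraRepK (uFormGroup (Fin 2) (Fin 1)) ϖ k v)
  haveI hZfd : FiniteDimensional ℂ Z := hV.kFinite v
  have hZK : ∀ (k : (uFormGroup (Fin 2) (Fin 1)).maximalCompact), ∀ z ∈ Z, harishChandraRepK (uFormGroup (Fin 2) (Fin 1)) ϖ k z ∈ Z := fun k z hz => GKTensor.kOrbitSpan_stable (uFormGroup (Fin 2) (Fin 1)) _ v k hz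
  have hvZ : v ∈ Z := IsGKModule.mem_span_orbit_self v
  have hZne : Z ⊓ ⊤ ≠ ⊥ := by
    rw [inf_top_eq]
    intro h
    exact hv ((Submodule.eq_bot_iff _).mp h v hvZ)
  haveI : Module.Finite ℂ ↥(Z ⊓ ⊤) := by rw [inf_top_eq]; infer_instance
  obtain ⟨W₀, hW₀Z, hW₀K, hW₀ne, hW₀irr⟩ := exists_irreducible_stable_le (σ := harishChandraRepK (uFormGroup (Fin 2) (Fin 1)) ϖ) ⊤ Z hZK hZne
    (fun Y _ _ hY => by rwa [inf_top_eq])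
  refine ⟨W₀, Submodule.finiteDimensional_of_le hW₀Z, ?_, hW₀K, hW₀irr⟩
  rwa [inf_top_eq] at hW₀ne

/-! ## §2 The linear multiplicity bound on `H_K^∞` (N1 + N3 + N4) -/

/-- **`dim Hom_K(τ, H_K^∞) ≤ d₀ · dim τ`** for a unitary globalization `ϖ` of an irreducible `(𝔤, K)`-class of `U(2,1)`, uniformly over irreducible
finite-dimensional `K`-modules `τ` (`d₀ = dim W₀` for any irreducible `K`-type `W₀` of `H_K^∞`); the `K`-action on `H_K^∞` in KF2's `subRep` currency.
[cite: Varadarajan1989, §5.4 Thm. 19] [cite: KnappVogan1995, Prop. 4.87] -/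
theorem hcModuleMultBound_uTwoOne {x : GKIrrClass (uFormGroup (Fin 2) (Fin 1))}
    {E : Type} [NormedAddCommGroup E] [InnerProductSpace ℂ E] [CompleteSpace E] {ϖ : ContRepresentation ℂ (uFormGroup (Fin 2) (Fin 1)).carrier E}
    (hϖ : IsUnitaryGlobalization (uFormGroup (Fin 2) (Fin 1)) x ϖ) :
    ∃ d₀ : ℕ, ∀ (W : Type) [AddCommGroup W] [Module ℂ W] [FiniteDimensional ℂ W]
      (τ : Representation ℂ (uFormGroup (Fin 2) (Fin 1)).maximalCompact W), τ.IsIrreducible →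
      FiniteDimensional ℂ (τ.IntertwiningMap
          ((ϖ.restrict (Subgroup.inclusion (uFormGroup (Fin 2) (Fin 1)).maximalCompact_le_carrier)).subRep
            (harishChandraSpace (uFormGroup (Fin 2) (Fin 1)) ϖ) ((uFormGroup (Fin 2) (Fin 1)).restrict_mem_harishChandraSpace))) ∧
        Module.finrank ℂ (τ.IntertwiningMap
          ((ϖ.restrict (Subgroup.inclusion (uFormGroup (Fin 2) (Fin 1)).maximalCompact_le_carrier)).subRep
            (harishChandraSpace (uFormGroup (Fin 2) (Fin 1)) ϖ) ((uFormGroup (Fin 2) (Fin 1)).restrict_mem_harishChandraSpace))) ≤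
          d₀ * Module.finrank ℂ W := by
  obtain ⟨W₀, hW₀fd, hW₀ne, hW₀K, hW₀irr⟩ := exists_irreducible_kStable_harishChandra hϖ
  haveI := hW₀fd
  -- N3: the level bound along the `𝔭`-filtration of `W₀`
  obtain ⟨B, hB⟩ := u21_levelBound hϖ W₀ hW₀K hW₀ne hW₀irr
  refine ⟨B, fun W _ _ _ τ hτ => ?_⟩
  -- N1: the chain `F n = upqPFiltration dϖ W₀ n` as `K`-subrepresentations: monotone, finite-dimensional, exhaustive
  let F : ℕ → Subrepresentation (harishChandraRepK (uFormGroup (Fin 2) (Fin 1)) ϖ) := fun n =>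
    { toSubmodule := upqPFiltration (harishChandraRepLie (uFormGroup (Fin 2) (Fin 1)) ϖ hϖ.isStronglyContinuous) W₀ n
      apply_mem_toSubmodule := fun k _ hv =>
        apply_mem_upqPFiltration_of_K_stable (harishChandraRepK (uFormGroup (Fin 2) (Fin 1)) ϖ) (isGKModule_harishChandra_uTwoOne hϖ) hW₀K n k hv }
  have hF : ∀ m, (F m).toSubmodule = upqPFiltration (harishChandraRepLie (uFormGroup (Fin 2) (Fin 1)) ϖ hϖ.isStronglyContinuous) W₀ m := fun m => rfl
  haveI hfd : ∀ m, FiniteDimensional ℂ (F m).toSubmodule := fun m => finiteDimensional_upqPFiltration W₀ m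
  have hmono : ∀ m, F m ≤ F (m + 1) := fun m =>
    show (F m).toSubmodule ≤ (F (m + 1)).toSubmodule from monotone_upqPFiltration _ W₀ (Nat.le_succ m)
  have hex : ∀ v : harishChandraSpace (uFormGroup (Fin 2) (Fin 1)) ϖ, ∃ n, v ∈ (F n).toSubmodule := fun v =>
    exists_mem_upqPFiltration (harishChandraRepK (uFormGroup (Fin 2) (Fin 1)) ϖ) (isGKModule_harishChandra_uTwoOne hϖ) hϖ.isIrreducibleGK_harishChandra hW₀K hW₀ne v
  -- N4 GLUE
  exact finite_and_finrank_intertwiningMap_harishChandra_le_of_filtration (uFormGroup (Fin 2) (Fin 1)) hϖ.isUnitary F hmono hex τ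
    (fun Q h1 h2 h3 h4 n => hB W τ hτ F hF Q h1 h2 h3 h4 n)

/-! ## §3 V19 at `U(2,1)` -/

/-- **HARISH-CHANDRA'S `K`-TYPE GROWTH BOUND FOR `U(2,1)` (V19 [Varadarajan1989 §5.4 Thm. 19 = HC1954] at `(p,q) = (2,1)`, PROVED):** for a unitary
globalization `ϖ` of an irreducible `(𝔤, K)`-class of `U(2,1)` there is `c` with `E(τ)` finite-dimensional and `dim E(τ) ≤ c · (dim τ)²` for every irreducible
finite-dimensional `K`-module `τ`.  The statement is ★ `IrreducibleUnitaryKTypeGrowth`'s body at `(Fin 2, Fin 1)` token for token (= ★ C1′ p831233's `h19`).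
[cite: Varadarajan1989, §5.4 Thm. 19] [cite: KnappVogan1995, Prop. 4.87] -/
theorem kTypeGrowth_uTwoOne :
    ∀ (x : GKIrrClass (uFormGroup (Fin 2) (Fin 1)))
      (E : Type) [NormedAddCommGroup E] [InnerProductSpace ℂ E] [CompleteSpace E]
      (ϖ : ContRepresentation ℂ (uFormGroup (Fin 2) (Fin 1)).carrier E),
      IsUnitaryGlobalization (uFormGroup (Fin 2) (Fin 1)) x ϖ →
      ∃ c : ℝ, ∀ (W : Type) [AddCommGroup W] [Module ℂ W] [FiniteDimensional ℂ W]
        (τ : Representation ℂ (uFormGroup (Fin 2) (Fin 1)).maximalCompact W), τ.IsIrreducible →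
        FiniteDimensional ℂ (Representation.homRangeSum
            (ϖ.restrict (Subgroup.inclusion (uFormGroup (Fin 2) (Fin 1)).maximalCompact_le_carrier)).toRepresentation τ) ∧
          (Module.finrank ℂ (Representation.homRangeSum
              (ϖ.restrict (Subgroup.inclusion (uFormGroup (Fin 2) (Fin 1)).maximalCompact_le_carrier)).toRepresentation τ) : ℝ) ≤
            c * (Module.finrank ℂ W : ℝ) ^ 2 := by
  intro x E _ _ _ ϖ hϖ
  obtain ⟨d₀, hd⟩ := hcModuleMultBound_uTwoOne hϖ
  exact ⟨(d₀ : ℝ), fun W _ _ _ τ hτ => kTypeGrowth_of_harishChandraMultiplicity hϖ hd W τ hτ⟩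

-- (The converse direction «letter ⇒ U(2,1) instance» is ★ `UnitaryGroup.kTypeGrowthU21_of_irreducibleUnitaryKTypeGrowth` (C1′ p831233) — not restated.)

end Literature.NumberTheory.Automorphic

end
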